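import Mathlib
import Summits.ResolutionOfSingularities.ResolutionOfSingularities.Theorems.WeightedInvariantLocalWeightedDropNCPolyBridgeExit

/-!
# `LocalWeightedDrop`, NC count game — TOT2-LINE piece S-CRV (v1.2 (G3) glue): the DISPATCH of the count-game bridge WITH EXPLICIT BOUNDARIES

[OURS · L1 W4.3 · chain w43, engine crux `LocalWeightedDrop` stmt-ResolutionOfSingularities-8899; piece S-CRV = res-type-088; `--supports 8899 --as helper`,
counted 0; definition-free; nothing here is a statement of any manuscript; AI-written (gate-accepted = sorry-free with standard axioms, not refereed).]

`NCPoly.succMove_of_represents` (lead-1, …NCPolyBridgeDispatch) concludes `∃ N′, Represents b′ d A′ N′` — the boundary of the successor is hidden.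
A letter-aware conflict budget (design note `plan/tools/res-type-088/S-CRV-D-DESIGN.md` v2.2/v2.3, draft `ConflictBudgetDefs.draft.lean`) needs the
boundary of every successor.  **`succMove_of_represents_bdry`** is the same dispatch with the four cases and their boundaries spelled out (the
boundaries of `NCPoly.curveMoveZero/One_of_represents` and `NCPoly.pointMove_of_represents`; the translated `u₁`-charts re-prepared as in
`NCPoly.pointMove_succ_of_represents`): a re-run of lead-1's proof, nothing new mathematically.
-/

set_option linter.dupNamespace false -- mandated namespace of this single-conjunct summit

noncomputable section

namespace Summit.ResolutionOfSingularities.ResolutionOfSingularities.Theorems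

namespace TOT2Curve

open MvPowerSeries PolyDescent MonicDescent WildMonic Literature.AlgebraicGeometry.Resolution TameFourTupleDrop

variable {k : Type} [Field k] {d : ℕ}

open scoped Classical in
/-- **THE DISPATCH WITH BOUNDARIES.**  From a position `b` representing a positive label `A` with boundary `N`, off the conflict states, one legal
count move has every successor unit × monomial or representing, according to the case of Σ**_d: (a′₁) `divOneT d A` with boundary
`{u₁} ∪ {u₂ : u₂ ∈ N}`; (a′₂) `divTwoT d A` with boundary `{u₂} ∪ {u₁ : u₁ ∈ N}`; (a″) the graph-curve successor
`divTwoT d (prep d (shearT (graphShearT d A) A))` with boundary `{u₂} ∪ {u₁ : u₁ ∈ N}`; (b) a point successor: `blowOneT d A` with boundary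
`{u₁} ∪ {u₂ : u₂ ∈ N}`, or `blowOneT d (prep d (shearT (C c) A))`, `c ≠ 0`, with boundary `{u₁}`, or `blowTwoT d A` with boundary `{u₂} ∪ {u₁ : u₁ ∈ N}`. -/
theorem succMove_of_represents_bdry (hd : 0 < d) {A : Fin d → MvPowerSeries (Fin 2) k} (hpos : IsPosT d A)
    {b : MvPowerSeries (Fin 3) k} {N : Finset (Fin 2)} (hrep : NCPoly.Represents b d A N)
    (hconf : ¬ IsPermissibleOneT d A → ¬ IsPermissibleTwoT d A → HasGraphCurveT d A → (1 : Fin 2) ∉ N) :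
    ∃ (Φ : Fin 3 → MvPowerSeries (Fin 3) k) (w : Fin 3 → ℕ), IsCountMove (m := 2) Φ w ∧
      MoveClause (m := 2) b Φ w (fun b' => NCPoly.IsStdNC b' ∨
        (IsPermissibleOneT d A ∧ NCPoly.Represents b' d (divOneT d A) (insert 0 (N.filter fun l => l = 1))) ∨
        (¬ IsPermissibleOneT d A ∧ IsPermissibleTwoT d A ∧ NCPoly.Represents b' d (divTwoT d A) (insert 1 (N.filter fun l => l = 0))) ∨
        (¬ IsPermissibleOneT d A ∧ ¬ IsPermissibleTwoT d A ∧ HasGraphCurveT d A ∧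
          NCPoly.Represents b' d (divTwoT d (prep d (shearT (graphShearT d A) A))) (insert 1 (N.filter fun l => l = 0))) ∨
        (¬ IsPermissibleOneT d A ∧ ¬ IsPermissibleTwoT d A ∧ ¬ HasGraphCurveT d A ∧
          (NCPoly.Represents b' d (blowOneT d A) (insert 0 (N.filter fun l => l = 1)) ∨
           (∃ c : k, c ≠ 0 ∧ NCPoly.Represents b' d (blowOneT d (prep d (shearT (C c) A))) {0}) ∨
           NCPoly.Represents b' d (blowTwoT d A) (insert 1 (N.filter fun l => l = 0))))) := by
  have hprep := stub_polyPrep k d hd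
  by_cases h1 : IsPermissibleOneT d A
  · obtain ⟨Φ, hmv, hcl⟩ := NCPoly.curveMoveZero_of_represents hpos (fun j => eq_X_pow_mul_divOneT h1 j) hrep
    exact ⟨Φ, _, hmv, hcl.mono fun b' hb' => hb'.imp_right fun h => Or.inl ⟨h1, h⟩⟩
  by_cases h2 : IsPermissibleTwoT d A
  · obtain ⟨Φ, hmv, hcl⟩ := NCPoly.curveMoveOne_of_represents hpos (fun j => eq_X_pow_mul_divTwoT h2 j) hrep
    exact ⟨Φ, _, hmv, hcl.mono fun b' hb' => hb'.imp_right fun h => Or.inr (Or.inl ⟨h1, h2, h⟩)⟩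
  by_cases h3 : HasGraphCurveT d A
  · -- (a″): shear (free off the conflict), prepare (free), row transfer, then the curve `V(y, ũ₂)`
    have h1N := hconf h1 h2 h3
    obtain ⟨ψ, -, -, hperm⟩ := graphShearT_spec h3
    set Y := shearT (graphShearT d A) A with hY
    have hposY : IsPosT d Y := isPosT_shearT _ hpos
    obtain ⟨hχ0, hposB, hWPB, -⟩ := isPrepRecentring_prepPsi (hprep Y hposY)
    have hBdef : prep d Y = shift d Y (prepPsi d Y) := rfl
    have hpermB : IsPermissibleTwoT d (prep d Y) := by
      refine isPermissibleTwoT_of_wellPrepared_of_isPermissibleTwoT_shift hd hWPB (φ := ψ - prepPsi d Y) ?_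
      rw [hBdef, PolyDescent.shift_shift, sub_add_cancel]
      exact hperm
    have hrepB : NCPoly.Represents b d (prep d Y) N := (hrep.shear h1N _).shift hχ0
    obtain ⟨Φ, hmv, hcl⟩ := NCPoly.curveMoveOne_of_represents (hBdef ▸ hposB) (fun j => eq_X_pow_mul_divTwoT hpermB j) hrepB
    exact ⟨Φ, _, hmv, hcl.mono fun b' hb' => hb'.imp_right fun h => Or.inr (Or.inr (Or.inl ⟨h1, h2, h3, h⟩))⟩
  · -- (b) the point
    obtain ⟨Φ, hmv, hcl⟩ := NCPoly.pointMove_of_represents hpos hrep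
    refine ⟨Φ, _, hmv, hcl.mono fun b' hb' => hb'.imp_right ?_⟩
    rintro ⟨c, -, (⟨hc0, h⟩ | ⟨hc0, hc1, h⟩)⟩
    · refine Or.inr (Or.inr (Or.inr ⟨h1, h2, h3, ?_⟩))
      by_cases hl : c 1 / c 0 = 0
      · -- the origin of the `u₁`-chart
        have hc1 : c 1 = 0 := by
          rcases div_eq_zero_iff.mp hl with h' | h'
          · exact h'
          · exact absurd h' hc0
        have hsh : shearT (C (c 1 / c 0)) A = A := by
          funext j; rw [hl, map_zero]; exact shear_zero_eq (A j)
        have hN : insert 0 (N.filter fun l => l = 1 ∧ c 1 = 0) = insert (0 : Fin 2) (N.filter fun l => l = 1) := by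
          congr 1
          exact Finset.filter_congr fun l _ => by rw [and_iff_left hc1]
        rw [hsh, hN] at h
        exact Or.inl h
      · -- a translated `u₁`-chart, re-prepared for free
        have hposY : IsPosT d (shearT (C (c 1 / c 0)) A) := isPosT_shearT _ hpos
        obtain ⟨hχ0, hposB, -, -⟩ := isPrepRecentring_prepPsi (hprep _ hposY)
        have hχ1 : (1 : ℕ∞) ≤ (prepPsi d (shearT (C (c 1 / c 0)) A)).order := one_le_order_iff_constCoeff_eq_zero.mpr hχ0
        have hcomm := blowOneT_shift (shearT (C (c 1 / c 0)) A) _ (fun j => (hposY j).le) hχ1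
        have hchi1 : constantCoeff (blowOne 1 (prepPsi d (shearT (C (c 1 / c 0)) A))) = 0 := by
          rw [constantCoeff_blowOne_one_eq]
          exact coeff_single_one_eq_zero_of_isPosT_shift hd hposY hχ0 hposB 0
        have hc1 : c 1 ≠ 0 := fun h' => hl (by rw [h', zero_div])
        have hN : insert 0 (N.filter fun l => l = 1 ∧ c 1 = 0) = ({0} : Finset (Fin 2)) := by
          rw [Finset.filter_false_of_mem (fun l _ => fun hh => hc1 hh.2), Finset.insert_empty]
        refine Or.inr (Or.inl ⟨c 1 / c 0, hl, ?_⟩)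
        rw [PolyDescent.prep, hcomm, ← hN]
        exact h.shift hchi1
    · exact Or.inr (Or.inr (Or.inr ⟨h1, h2, h3, Or.inr (Or.inr h)⟩))

end TOT2Curve

end Summit.ResolutionOfSingularities.ResolutionOfSingularities.Theorems

end
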